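import Summits.ValiantsHypothesis.ValiantsHypothesis.Theorems.VPBoundarySquareBorderTransfer
import Summits.ValiantsHypothesis.ValiantsHypothesis.Theorems.SuccinctLiftGenericSkeletons
import Literature.Computability.AlgebraicComplexity.BorderComplexityAlder
import Literature.Computability.AlgebraicComplexity.AndrewsForbes2022Thm68Proofs
import HarnessLib

/-!
# Route `VPBoundarySquare` — the two border currencies of the product-depth dial coincide (Alder–Strassen for wires × product-depth)

Decomp-valiant workshop, lens 3 «border-complexity / debordering axis», generation 30; census cell V28
(«Zariski currency of V27»).  Unconditional, 0 sorry, no named fact; a CALIBRATION of the lens-3 record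
(`Theorems/VPBoundarySquareBorderTransfer.lean`): it does NOT prove `VP ≠ VNP`, moves no tag and closes no
crux of the route (statements of record, split and `closes` unchanged).

THE GAP IT CLOSES.  The lens-3 dial `Ā_Δ := ¬ PerInBorderDepthPoly Δ` is typed in the tree's ZARISKI border
(`BorderDepthClass σ Δ s` = coefficient vectors in the Zariski closure of those of `DepthClass σ Δ s`, BLMW 2011
Def. 9.3.1), while every border LOWER BOUND the tree holds for constant product-depth is typed in the
Andrews–Forbes `ε`-border (`borderClass F 𝒞`: `h = f + O(ε)` coefficientwise for an `h` computed over `F((ε))`,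
AF 2022 Def. 2.1) — in particular V27, `DecompCycle1CPerBorderConstDepth.perPoly_not_mem_borderClass_constDepth`
(`per ∉` the `ε`-border of p-bounded-wire product-depth-`Δ₀` circuits, every constant `Δ₀`).  Over `ℂ` the two
borders of the SAME exact class agree (Alder 1984 / Strassen; Bürgisser 2004 Thm. 2.2 for `{L ≤ r}`; in the tree
for fan-in-two size as `borderComplexity_le_iff_coeffVec_mem_zariskiClosure`), but that equivalence was in the
tree only for the fan-in-two size measure `complexity`, not for the unbounded-fan-in class
`productDepthEdgeClass k σ s Δ` (wires `≤ s`, product-depth `≤ Δ`) the dial is built on.  This file proves it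
for that class; its leaf `VPBoundarySquareBorderDepthConst.lean` cashes V27 in the dial's own currency.

WHAT IS PROVED.
* §2 (any infinite field `F`) `coeffVec_mem_zariskiClosure_of_mem_borderClass`: the `ε`-border of
  `productDepthEdgeClass F((ε)) σ s Δ` lies in the Zariski border of `productDepthEdgeClass F σ s Δ` — the
  generic-constants argument (replace the constants of the border circuit by indeterminates; a polynomial in
  the coefficients vanishing on the class vanishes identically in the indeterminates, hence at the border
  circuit, hence — having coefficients in `F` — at `ε = 0`); wires and product-depth are constant-blind
  (`edgeSize_mapCoeff`, `productDepth_mapCoeff`).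
* §3 (algebraically closed `K`, finitely many variables) `mem_borderClass_of_coeffVec_mem_zariskiClosure`: the
  converse — Alder's theorem for the class: normalise an exact circuit to a well-formed one with `≤ s` gates
  (`exists_wellFormed_size_le_edgeSize`), so the class is covered by the polynomial images
  `a ↦ (sk.mapConsts a).eval` of FINITELY many constant-free skeletons `sk` with `≤ 2s+1` constant symbols
  (`finite_skeletons_of_fanIn_le`, `exists_skeleton`, `coeff_eval_mapConsts`); the closure of a finite union
  is the union of the closures (`zariskiClosure_iUnion_subset`); a point of the closure of ONE image is reached
  by a `K((ε))`-valued point of the symbols under which every coefficient is a power series with the right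
  constant term (the curve lemma BCS (20.28) in Laurent form, `LaurentPoints.exists_laurentSeries_of_ker_le`);
  that point turns the skeleton into the border circuit, with the same wires and product-depth.
* §4 `mem_borderClass_productDepthEdgeClass_iff`; hence over `ℂ` the dial's two currencies coincide:
  `borderDepthClass_eq_borderClass` (`D̄(σ, Δ, s) = borderClass ℂ (productDepthEdgeClass ℂ((ε)) σ s Δ)`),
  `perInBorderDepthPoly_iff_borderClass`, `not_perInBorderDepthPoly_iff_borderHard` (`Ā_Δ` iff `per` is in the
  `ε`-border for no p-bounded wire budget).  The leaf file `VPBoundarySquareBorderDepthConst.lean` (which must sit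
  in the theses-cone of `DecompCycle1C`, where V27 lives) cashes V27: `Ā_{Δ₀}` for every CONSTANT `Δ₀`, hence
  equation certificates against `per` at every polynomial budget, `per` is not a boundary family of any
  constant-depth class (case (iii) of `dial_trichotomy`), and `B̄_{Δ₀} ↔ VH`.  This file is route-independent.

Print status: Alder–Strassen / Bürgisser 2004 Thm. 2.2 is stated in print for fan-in-two size and for border
rank; that "continuous" (rank / flattening) lower bounds such as LST's survive in the border is AF 2022 Cor. 6.5
and folklore of GCT (Landsberg 2017 §8.2, BLMW 2011 §9.3).  Kernel-new only as the transfer of the equivalence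
to the wires × product-depth class and the resulting Zariski-border form of the constant-depth permanent bound.
It says nothing about growing depth (`Δ₁ = log log log`, lens 4) or about `VP ≠ VNP`.

References: [Burgisser2004Factors] Thm. 2.2; [BurgisserClausenShokrollahi1997] Lemma (20.28), Thm. (20.24);
[BurgisserEtAl2011] Def. 9.3.1, §9.3; [AndrewsForbes2022] Def. 2.1, §6.1, Cor. 6.5; [LandsbergGCT2017] §8.2.
-/

-- layout Summits/ValiantsHypothesis/ValiantsHypothesis forces the duplicated namespace component
set_option linter.dupNamespace false

namespace Summit.ValiantsHypothesis.ValiantsHypothesis.Theorems.VPBoundarySquare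

open MvPolynomial Literature.Computability.AlgebraicComplexity ArithCircuit
open Summit.ValiantsHypothesis.ValiantsHypothesis.Theorems.SuccinctLift.Bookkeeping

noncomputable section

universe u v

/-! ## §1 Two `O(ε)` estimates (re-derived: the upstream versions are file-private) -/

/-- Evaluating a polynomial with coefficients in `F` at two `F((ε))`-points that are `O(1)` and agree modulo `ε`
gives `O(1)` values that agree modulo `ε`. [folklore] -/
theorem isOrdGE_aeval_sub_aeval_of_close {F : Type u} [Field F] {τ : Type*} (P : MvPolynomial τ F)
    {x y : τ → LaurentSeries F} (hx : ∀ t, IsOrdGE 0 (x t)) (hy : ∀ t, IsOrdGE 0 (y t))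
    (hxy : ∀ t, IsOrdGE 1 (x t - y t)) :
    IsOrdGE 0 (aeval x P) ∧ IsOrdGE 0 (aeval y P) ∧ IsOrdGE 1 (aeval x P - aeval y P) := by
  induction P using MvPolynomial.induction_on with
  | C a =>
    simp only [algHom_C, algebraMap_laurentSeries_apply, sub_self]
    exact ⟨IsOrdGE.C a, IsOrdGE.C a, IsOrdGE.zero 1⟩
  | add p q hp hq =>
    obtain ⟨hp0, hp1, hp2⟩ := hp
    obtain ⟨hq0, hq1, hq2⟩ := hq
    refine ⟨?_, ?_, ?_⟩
    · rw [map_add]; exact hp0.add hq0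
    · rw [map_add]; exact hp1.add hq1
    · have : aeval x (p + q) - aeval y (p + q) = (aeval x p - aeval y p) + (aeval x q - aeval y q) := by
        rw [map_add, map_add]; ring
      rw [this]; exact hp2.add hq2
  | mul_X p t hp =>
    obtain ⟨hp0, hp1, hp2⟩ := hp
    refine ⟨?_, ?_, ?_⟩
    · rw [map_mul, aeval_X]; simpa using hp0.mul (hx t)
    · rw [map_mul, aeval_X]; simpa using hp1.mul (hy t)
    · have : aeval x (p * X t) - aeval y (p * X t) =
          (aeval x p - aeval y p) * x t + aeval y p * (x t - y t) := by
        rw [map_mul, map_mul, aeval_X, aeval_X]; ring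
      rw [this]
      have h1 := hp2.mul (hx t)
      have h2 := hp1.mul (hxy t)
      simp only [add_zero, zero_add] at h1 h2
      exact h1.add h2

/-- A power series minus its constant coefficient is `O(ε)` in `K((ε))`. [folklore] -/
theorem isOrdGE_one_coe_sub_C_constantCoeff {K : Type u} [Field K] (q : PowerSeries K) :
    IsOrdGE 1 ((q : LaurentSeries K) - HahnSeries.C (PowerSeries.constantCoeff q)) := by
  intro i hi
  rw [HahnSeries.coeff_sub, PowerSeries.coeff_coe, HahnSeries.C_apply]
  by_cases h0 : i = 0
  · subst h0
    simp
  · have hneg : i < 0 := lt_of_le_of_ne (by omega) h0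
    rw [if_pos hneg, HahnSeries.coeff_single_of_ne h0, sub_zero]

/-! ## §2 The `ε`-border of the wires × product-depth class lies in its Zariski border (any infinite field) -/

section EpsToZariski

variable {F : Type u} [Field F] [Infinite F] {σ : Type v}

/-- **`ε`-border ⊆ Zariski border for `productDepthEdgeClass`** (Bürgisser 2004 Thm. 2.2, easy inclusion, run
for wires and product-depth instead of size): if `f ∈ F[x_σ]` is `h + O(ε)` for an `h` computed over `F((ε))`
with `≤ s` wires and product-depth `≤ Δ`, then `coeffVec f` lies in the Zariski closure of the coefficient
vectors of `productDepthEdgeClass F σ s Δ`.  Generic-constants argument; `F` infinite.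
[cite: Burgisser2004Factors, Thm. 2.2 (easy inclusion)] [cite: AndrewsForbes2022, Def. 2.1, §6.1] -/
theorem coeffVec_mem_zariskiClosure_of_mem_borderClass {s Δ : ℕ} {f : MvPolynomial σ F}
    (hf : f ∈ borderClass F (productDepthEdgeClass (LaurentSeries F) σ s Δ)) :
    coeffVec f ∈ zariskiClosure (coeffVec '' productDepthEdgeClass F σ s Δ) := by
  classical
  obtain ⟨h, ⟨C, hCh, hCΔ, hCs⟩, hh⟩ := hf
  rw [mem_zariskiClosure_iff]
  intro P hP
  -- generic constants: `A = F[X_γ : γ ∈ F((ε))]`, `ψ : X_γ ↦ γ`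
  set ψ : MvPolynomial (LaurentSeries F) F →ₐ[F] LaurentSeries F := aeval id with hψ
  set Ct : ArithCircuit (MvPolynomial (LaurentSeries F) F) σ :=
    C.mapConsts (X : LaurentSeries F → MvPolynomial (LaurentSeries F) F) with hCt
  have hback : Ct.map (ψ : MvPolynomial (LaurentSeries F) F →+* LaurentSeries F) = C := by
    refine ArithCircuit.map_mapConsts_eq_self _ _ C fun c _ => ?_
    rw [hψ]; simp
  have hHh : MvPolynomial.map (ψ : MvPolynomial (LaurentSeries F) F →+* LaurentSeries F) Ct.eval = h := by
    rw [← ArithCircuit.eval_map_apply, hback]; exact hCh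
  -- every specialisation of the generic circuit has the same wires and product-depth as `C`
  have hΔ' : ∀ {B : Type u} [CommSemiring B] (φ : MvPolynomial (LaurentSeries F) F →+* B),
      (Ct.map φ).productDepth ≤ Δ := by
    intro B _ φ
    have h0 := productDepth_mapCoeff (ψ : MvPolynomial (LaurentSeries F) F →+* LaurentSeries F) Ct
    rw [hback] at h0
    rw [productDepth_mapCoeff, ← h0]
    exact hCΔ
  have hs' : ∀ {B : Type u} [CommSemiring B] (φ : MvPolynomial (LaurentSeries F) F →+* B),
      (Ct.map φ).edgeSize ≤ s := by
    intro B _ φ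
    have h0 := edgeSize_mapCoeff (ψ : MvPolynomial (LaurentSeries F) F →+* LaurentSeries F) Ct
    rw [hback] at h0
    rw [edgeSize_mapCoeff, ← h0]
    exact hCs
  have hspec : ∀ a : LaurentSeries F → F,
      MvPolynomial.map ((aeval a : MvPolynomial (LaurentSeries F) F →ₐ[F] F) :
        MvPolynomial (LaurentSeries F) F →+* F) Ct.eval ∈ productDepthEdgeClass F σ s Δ :=
    fun a => ⟨Ct.map _, ArithCircuit.eval_map_apply _ _, hΔ' _, hs' _⟩
  -- the polynomial `Pgen = P(coeff H̃)` in the generic constants vanishes at every `F`-point, hence is `0`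
  set Pgen : MvPolynomial (LaurentSeries F) F := aeval (fun d => coeff d Ct.eval) P with hPgen
  have hnat : ∀ {B : Type u} [CommRing B] [Algebra F B]
      (θ : MvPolynomial (LaurentSeries F) F →ₐ[F] B),
      θ Pgen = aeval (fun d => coeff d (MvPolynomial.map (θ : MvPolynomial (LaurentSeries F) F →+* B)
        Ct.eval)) P := by
    intro B _ _ θ
    rw [hPgen, ← AlgHom.comp_apply, MvPolynomial.comp_aeval]
    congr 1
  have hPgen0 : Pgen = 0 := by
    refine MvPolynomial.funext fun a => ?_
    have h1 : eval a Pgen =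
        aeval (fun d => coeff d (MvPolynomial.map (eval a) Ct.eval)) P := hnat (aeval a)
    rw [map_zero, h1]
    exact hP (coeffVec (MvPolynomial.map (eval a) Ct.eval)) ⟨_, hspec a, rfl⟩
  -- hence `P(coeff h) = 0` in `F((ε))`
  have hPh : aeval (fun d => coeff d h) P = 0 := by
    have := hnat ψ
    rw [hPgen0, map_zero, hHh] at this
    exact this.symm
  -- and `P(coeff h) = P(coeff f) + O(ε)` since `P` has coefficients in `F`
  have hx : ∀ d, IsOrdGE 0 (coeff d h) := fun d => by
    have : h = (h - MvPolynomial.map (algebraMap F (LaurentSeries F)) f) +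
        MvPolynomial.map (algebraMap F (LaurentSeries F)) f := by ring
    rw [this, coeff_add]
    exact ((hh d).mono zero_le_one).add (PolyOrdGE.map_algebraMap f d)
  have hy : ∀ d, IsOrdGE 0 (coeff d (MvPolynomial.map (algebraMap F (LaurentSeries F)) f)) :=
    fun d => PolyOrdGE.map_algebraMap f d
  have hxy : ∀ d, IsOrdGE 1 (coeff d h - coeff d (MvPolynomial.map (algebraMap F (LaurentSeries F)) f)) :=
    fun d => by rw [← coeff_sub]; exact hh d
  obtain ⟨-, -, hdiff⟩ := isOrdGE_aeval_sub_aeval_of_close P hx hy hxy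
  rw [hPh, zero_sub] at hdiff
  have hconst : aeval (fun d => coeff d (MvPolynomial.map (algebraMap F (LaurentSeries F)) f)) P =
      algebraMap F (LaurentSeries F) (aeval (coeffVec f) P) := by
    change _ = (Algebra.ofId F (LaurentSeries F)) (aeval (coeffVec f) P)
    rw [← AlgHom.comp_apply, MvPolynomial.comp_aeval]
    congr 1
  rw [hconst, algebraMap_laurentSeries_apply] at hdiff
  have := hdiff.neg
  rw [neg_neg] at this
  have h0 := this 0 zero_lt_one
  rwa [HahnSeries.C_apply, HahnSeries.coeff_single_same] at h0

end EpsToZariski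

/-! ## §3 Alder's theorem for the class: the Zariski border lies in the `ε`-border (algebraically closed field) -/

section ZariskiToEps

-- `K : Type` (universe 0, e.g. `ℂ`): the tree's plain-map bookkeeping lemmas for skeletons
-- (`productDepth_mapConsts'`, `refsLT_mapConsts'`, `forall_fanIn_le_mapConsts`) are universe-monomorphic and the
-- skeleton symbols `Fin T` live in `Type`.
variable {K : Type} [Field K] [IsAlgClosed K] {σ : Type v} [Fintype σ] [DecidableEq σ]

/-- **Zariski border ⊆ `ε`-border for `productDepthEdgeClass`** (Alder's theorem / Bürgisser 2004 Thm. 2.2, the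
hard inclusion, for wires and product-depth): over an algebraically closed field (in `Type`), if `coeffVec f` lies in the
Zariski closure of the coefficient vectors of `productDepthEdgeClass K σ s Δ`, then `f = h + O(ε)` for an `h`
computed over `K((ε))` with `≤ s` wires and product-depth `≤ Δ`.  Proof in the module docstring (finitely many
skeletons, closure of a finite union, the curve lemma BCS (20.28)).
[cite: Burgisser2004Factors, Thm. 2.2] [cite: BurgisserClausenShokrollahi1997, Lemma (20.28)]
[cite: AndrewsForbes2022, Def. 2.1, §6.1] -/
theorem mem_borderClass_of_coeffVec_mem_zariskiClosure {s Δ : ℕ} (f : MvPolynomial σ K)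
    (hf : coeffVec f ∈ zariskiClosure (coeffVec '' productDepthEdgeClass K σ s Δ)) :
    f ∈ borderClass K (productDepthEdgeClass (LaurentSeries K) σ s Δ) := by
  classical
  -- §1: finitely many skeletons with `T = 2s+1` constant symbols cover the class
  set T : ℕ := 2 * s + 1 with hT
  let Sk : Set (ArithCircuit (Fin T) σ) :=
    {sk | (sk.size ≤ s ∧ (∀ g ∈ sk.gates, g.fanIn ≤ s) ∧ RefsLT s sk) ∧
      sk.productDepth ≤ Δ ∧ sk.edgeSize ≤ s}
  have hfin : Sk.Finite := (finite_skeletons_of_fanIn_le s s T).subset fun sk hsk => hsk.1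
  haveI : Finite Sk := hfin.to_subtype
  let G : Sk → MvPolynomial σ (MvPolynomial (Fin T) K) := fun sk => genericEval (F := K) sk.1
  let Φ : Sk → (Fin T → K) → MvPolynomial σ K := fun sk a => MvPolynomial.map (MvPolynomial.eval a) (G sk)
  have hcover : coeffVec '' productDepthEdgeClass K σ s Δ ⊆ ⋃ sk, coeffVec '' Set.range (Φ sk) := by
    rintro _ ⟨g, ⟨P, hPg, hPΔ, hPs⟩, rfl⟩
    obtain ⟨N, hNwf, hNev, hNΔ, hNs, hNsz⟩ := exists_wellFormed_size_le_edgeSize P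
    have hNs' : N.edgeSize ≤ s := hNs.trans hPs
    have hNsize : N.size ≤ s := hNsz.trans hPs
    have hlen : N.consts.length ≤ T := (length_consts_le_edgeSize N).trans (by omega)
    obtain ⟨ψ, c, hN⟩ := exists_skeleton (by omega) N hlen
    have hsk : N.mapConsts ψ ∈ Sk := by
      refine ⟨⟨?_, forall_fanIn_le_mapConsts ψ fun g hg => (fanIn_le_edgeSize_of_mem N hg).trans hNs',
        refsLT_mapConsts' ψ (refsLT_of_wellFormed hNwf hNsize)⟩, ?_, ?_⟩
      · rw [size_mapConsts]; exact hNsize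
      · rw [productDepth_mapConsts']; exact hNΔ.trans hPΔ
      · rw [edgeSize_mapConsts]; exact hNs'
    have hev : ((N.mapConsts ψ).mapConsts c).eval = g := by
      rw [hN, hNev]; exact hPg
    have hΦ : Φ ⟨N.mapConsts ψ, hsk⟩ c = g := by
      rw [← hev]
      ext m
      simp only [Φ, G, coeff_map, coeff_eval_mapConsts]
    exact Set.mem_iUnion.2 ⟨⟨N.mapConsts ψ, hsk⟩, g, ⟨c, hΦ⟩, rfl⟩
  -- §2: `coeffVec f` lies in the closure of ONE image
  obtain ⟨sk, hsh⟩ := Set.mem_iUnion.mp (zariskiClosure_iUnion_subset _ (zariskiClosure_mono hcover hf))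
  have hsk2 : (sk.1.size ≤ s ∧ (∀ g ∈ sk.1.gates, g.fanIn ≤ s) ∧ RefsLT s sk.1) ∧
      sk.1.productDepth ≤ Δ ∧ sk.1.edgeSize ≤ s := sk.2
  -- §3: the kernel condition on the finitely many monomials that occur
  let S : Finset (σ →₀ ℕ) := (G sk).support ∪ f.support
  let Pc : S → MvPolynomial (Fin T) K := fun t => coeff (t : σ →₀ ℕ) (G sk)
  have hker : RingHom.ker (aeval Pc : MvPolynomial S K →ₐ[K] MvPolynomial (Fin T) K) ≤
      RingHom.ker (aeval (fun t : S => coeff (t : σ →₀ ℕ) f) : MvPolynomial S K →ₐ[K] K) := by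
    intro Q hQ
    rw [RingHom.mem_ker] at hQ ⊢
    have hvan : ∀ y ∈ coeffVec '' Set.range (Φ sk), aeval y (rename (fun t : S => (t : σ →₀ ℕ)) Q) = 0 := by
      rintro _ ⟨_, ⟨a, rfl⟩, rfl⟩
      rw [aeval_rename]
      have hfun : (coeffVec (Φ sk a) ∘ fun t : S => (t : σ →₀ ℕ)) = fun t => aeval a (Pc t) := by
        funext t
        simp only [Function.comp_apply, coeffVec_apply, Φ, coeff_map, Pc]
        rfl
      rw [hfun, ← comp_aeval, AlgHom.comp_apply, hQ, map_zero]
    have h0 := (mem_zariskiClosure_iff.mp hsh) _ hvan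
    rwa [aeval_rename] at h0
  -- the Laurent point (BCS Lemma (20.28), Laurent form)
  obtain ⟨Ψ, hΨ⟩ := LaurentPoints.exists_laurentSeries_of_ker_le Pc hker
  -- §4: the border circuit = the skeleton with constants `Ψ(X_j)`: same wires, same product-depth
  let C : ArithCircuit (LaurentSeries K) σ :=
    (sk.1.mapConsts fun j => (X j : MvPolynomial (Fin T) K)).map
      (Ψ : MvPolynomial (Fin T) K →+* LaurentSeries K)
  have hCeval : C.eval = MvPolynomial.map (Ψ : MvPolynomial (Fin T) K →+* LaurentSeries K) (G sk) :=
    ArithCircuit.eval_map_apply _ _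
  have hCΔ : C.productDepth ≤ Δ := by
    show ((sk.1.mapConsts fun j => (X j : MvPolynomial (Fin T) K)).map _).productDepth ≤ Δ
    rw [productDepth_mapCoeff, productDepth_mapConsts']
    exact hsk2.2.1
  have hCs : C.edgeSize ≤ s := by
    show ((sk.1.mapConsts fun j => (X j : MvPolynomial (Fin T) K)).map _).edgeSize ≤ s
    rw [edgeSize_mapCoeff, edgeSize_mapConsts]
    exact hsk2.2.2
  refine ⟨C.eval, ⟨C, rfl, hCΔ, hCs⟩, fun m => ?_⟩
  rw [coeff_sub, coeff_map, hCeval, coeff_map, algebraMap_laurentSeries_apply]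
  by_cases hm : m ∈ S
  · obtain ⟨q, hq, hq0⟩ := hΨ ⟨m, hm⟩
    change IsOrdGE 1 (Ψ (Pc ⟨m, hm⟩) - HahnSeries.C (coeff m f))
    rw [hq, ← hq0]
    exact isOrdGE_one_coe_sub_C_constantCoeff q
  · have hm' : m ∉ (G sk).support ∧ m ∉ f.support := by
      simpa only [S, Finset.mem_union, not_or] using hm
    rw [notMem_support_iff.mp hm'.1, notMem_support_iff.mp hm'.2, map_zero, map_zero, sub_zero]
    exact IsOrdGE.zero 1

/-- **Alder–Strassen for wires × product-depth, as an equivalence** (algebraically closed field, finitely many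
variables): `f` is in the `ε`-border of `productDepthEdgeClass K((ε)) σ s Δ` iff `coeffVec f` is in the
Zariski closure of the coefficient vectors of `productDepthEdgeClass K σ s Δ`.
[cite: Burgisser2004Factors, Thm. 2.2] [cite: BurgisserEtAl2011, Def. 9.3.1] [cite: AndrewsForbes2022, Def. 2.1] -/
theorem mem_borderClass_productDepthEdgeClass_iff {s Δ : ℕ} (f : MvPolynomial σ K) :
    f ∈ borderClass K (productDepthEdgeClass (LaurentSeries K) σ s Δ) ↔
      coeffVec f ∈ zariskiClosure (coeffVec '' productDepthEdgeClass K σ s Δ) :=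
  ⟨coeffVec_mem_zariskiClosure_of_mem_borderClass, mem_borderClass_of_coeffVec_mem_zariskiClosure f⟩

end ZariskiToEps

/-! ## §4 Over `ℂ` the dial's two currencies coincide -/

/-- The dial's exact class IS the Andrews–Forbes §6 class over `ℂ` (same sentence). [cite: AndrewsForbes2022, §6.1] -/
theorem depthClass_eq_productDepthEdgeClass (σ : Type*) (Δ s : ℕ) :
    DepthClass σ Δ s = productDepthEdgeClass ℂ σ s Δ := rfl

/-- **The two border currencies coincide**: the Zariski border `D̄(σ, Δ, s)` of the dial equals the `ε`-border
of the wires × product-depth class over `ℂ((ε))`. [cite: Burgisser2004Factors, Thm. 2.2] [cite: BurgisserEtAl2011, Def. 9.3.1] -/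
theorem borderDepthClass_eq_borderClass (σ : Type*) [Fintype σ] [DecidableEq σ] (Δ s : ℕ) :
    BorderDepthClass σ Δ s = borderClass ℂ (productDepthEdgeClass (LaurentSeries ℂ) σ s Δ) := by
  ext f
  rw [mem_borderDepthClass_iff, depthClass_eq_productDepthEdgeClass]
  exact (mem_borderClass_productDepthEdgeClass_iff f).symm

/-- `per ∈ D̄_Δ[poly]` in the `ε`-currency: iff for some p-bounded wire budget `s`, every `per_n` is in the
`ε`-border of product-depth-`Δ n` circuits with `≤ s n` wires. [cite: AndrewsForbes2022, Def. 2.1, §6.1] -/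
theorem perInBorderDepthPoly_iff_borderClass (Δ : ℕ → ℕ) :
    PerInBorderDepthPoly Δ ↔ ∃ s : ℕ → ℕ, IsPBounded s ∧ ∀ n : ℕ, perPoly (Fin n) ℂ ∈
      borderClass ℂ (productDepthEdgeClass (LaurentSeries ℂ) (Fin n × Fin n) (s n) (Δ n)) := by
  constructor
  · rintro ⟨c, hc⟩
    refine ⟨fun n => n ^ c + c, ⟨c, fun n => le_rfl⟩, fun n => ?_⟩
    rw [← borderDepthClass_eq_borderClass]
    exact hc n
  · rintro ⟨s, ⟨c, hc⟩, hs⟩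
    refine ⟨c, fun n => ?_⟩
    rw [borderDepthClass_eq_borderClass]
    exact borderClass_mono (productDepthEdgeClass_mono₂ _ _ (hc n) le_rfl) (hs n)

/-- **Border hardness of `per` transfers between the currencies**: `Ā_Δ` (Zariski border, the dial) iff `per` is
in the `ε`-border of product-depth-`Δ n` circuits for NO p-bounded wire budget — the form in which the tree's
border lower bounds are typed (Andrews–Forbes Cor. 6.5 engine; for constant `Δ` this right-hand side is
`DecompCycle1CPerBorderConstDepth.perPoly_not_mem_borderClass_constDepth`, cashed in the leaf file
`VPBoundarySquareBorderDepthConst`). [cite: AndrewsForbes2022, Def. 2.1, Cor. 6.5] -/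
theorem not_perInBorderDepthPoly_iff_borderHard (Δ : ℕ → ℕ) :
    ¬ PerInBorderDepthPoly Δ ↔ ¬ ∃ s : ℕ → ℕ, IsPBounded s ∧ ∀ n : ℕ, perPoly (Fin n) ℂ ∈
      borderClass ℂ (productDepthEdgeClass (LaurentSeries ℂ) (Fin n × Fin n) (s n) (Δ n)) :=
  not_congr (perInBorderDepthPoly_iff_borderClass Δ)

end

end Summit.ValiantsHypothesis.ValiantsHypothesis.Theorems.VPBoundarySquare
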